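import Summits.BirchSwinnertonDyer.BirchSwinnertonDyer.Theorems.AdditiveKolyvaginRoadToricLocalDefs
import Summits.BirchSwinnertonDyer.BirchSwinnertonDyer.Theorems.AdditiveKolyvaginRoadLocalFrobenius
import Summits.BirchSwinnertonDyer.Rank1Residual.GaloisImage.LocalH1TorsionBounded
import Literature.NumberTheory.GaloisRepresentations.LocalGaloisGroupFrobeniusProofs
import Literature.NumberTheory.GaloisRepresentations.LocalGaloisGroupProofs
import Literature.NumberTheory.EllipticCurves.LocalH1TateDualityLangTateProofs
import Summits.BirchSwinnertonDyer.Rank1Residual.X11b.KummerPoitouTateExact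
import Literature.NumberTheory.GaloisRepresentations.WildInertia
import Literature.NumberTheory.GaloisRepresentations.TateLevelOneLocalCharacters
import Literature.NumberTheory.Automorphic.AdicCompletionResidueCard
import HarnessLib

/-!
# Route `AdditiveKolyvaginRoad`, crux `KolyvaginPrimitiveAdditive` (item stmt-BirchSwinnertonDyer-20132), stub LOC,
# towards (Supply) at a general prime `p` — (Lag-tor), COUNT clause: at the place above a Bertolini–Darmon
# admissible prime the genuine toric condition has `#H¹(K_w, E[p]) ≤ #Ltor · #Ltor`
# (cell `pub/bsd-wall`, lead prover `bsd-wall-akr-p1` g4; `--supports stmt-BirchSwinnertonDyer-20132`, helper)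

WHY. The last missing LOCAL input of (Supply) (W. Zhang's Lemma 8.2 for the level structure; PORT MAP of akr-p1 g3,
clause (c)): with the isotropy `htorIso_toricLocalCondition` (p551130) it makes `Ltor_w = toricLocalCondition (W/K) K_w p`
LAGRANGIAN for the local Tate pairing at the place `w` of the quadratic `K` above a BD-admissible `q` (`q ∤ pN`, `q` inert,
`p ∤ q² − 1`, `a_q ≡ ±(q+1)`), as Poitou–Tate duality (the jump `hjump`) requires above the level.

ARGUMENT (no Kummer theory; Bertolini–Darmon §2.3 `H¹(K_q, E[p]) = H¹_fin ⊕ H¹_ord`, counted through `E[p]/A`,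
`A = ⟨res τ · y − y⟩` the augmentation subgroup of `Γ_{K_w}`): §1 over any non-archimedean local field `F`, a continuous
homomorphism `Γ_F → Q` of exponent `p` with `p ≠ char 𝓀_F`, `p ∤ q_F − 1` KILLS INERTIA (wild inertia is pro-`char 𝓀_F`,
`absWildInertia_isProP_holds`; `φ σ φ⁻¹ σ^{−q_F}` is wild, Serre's "`s u s⁻¹ ≡ u^q`", `conj_mul_pow_inv_mem_absWildInertia`);
§2 at `w ∣ q`: `p ∤ q_w − 1` (`q_w ∣ q²`), `#E[p]^{Γ_{K_w}} ≥ p` (Frobenius-fixed line), `#H¹(K_w, E[p]) = (#H⁰)² ≥ p²`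
(Tate's prime-to-`p` Euler characteristic, tree THEOREM `natCard_invariants_mul_natCard_two_eq`), `#A ≥ p`; §3 for a local
class `[ψ]`, `σ ↦ ψ σ mod A` is a continuous homomorphism `Γ_{K_w} → E[p]/A`, unramified (§1), so determined by its value
at a Frobenius (`exists_zpow_eq_of_absInertia_le_ker`); equal values ⟹ the classes differ by an element of `Ltor`. Hence
`#H¹ ≤ #(E[p]/A) · #Ltor ≤ p · #Ltor` and `#H¹(K_w, E[p]) ≤ #Ltor · #Ltor`.

HONEST FRAMING: theorems only; 0 definitions, 0 named facts, 0 `sorry`; local Galois cohomology of `E[p]`; closes nothing.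

References: [cite: BertoliniDarmon2005, §2.2–§2.3, Lemma 2.6] [cite: WZhang2014, §4.1, Prop. 5.4] [cite: MilneADT2006, Ch. I
§2, Thm. 2.8, Cor. 2.3] [cite: SerreLocalFields1979, Ch. IV §2, Ex. 2] [cite: SerreInventiones1972, §1.8 Prop. 6].
-/

-- single-conjunct summit: `Summit.BirchSwinnertonDyer.BirchSwinnertonDyer.…` repeats the name by design
set_option linter.dupNamespace false

noncomputable section

open scoped Classical Pointwise

universe u

namespace Summit.BirchSwinnertonDyer.BirchSwinnertonDyer.Theorems.AdditiveKoly

open CategoryTheory WeierstrassCurve Field Function NumberField IsDedekindDomain ValuativeRel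
open Literature.NumberTheory.EllipticCurves Literature.NumberTheory.GaloisRepresentations
open Literature.NumberTheory.GaloisRepresentations.IsNonarchimedeanLocalField
open Summit.BirchSwinnertonDyer.Rank1Residual.X11b.Three.Koly.Method2
open Summit.BirchSwinnertonDyer.Rank1Residual.GaloisImage Summit.BirchSwinnertonDyer.Rank1Residual.X11b
open scoped ContRepresentation

/-! ## §1 Continuous homomorphisms of exponent `p` kill the inertia group when `p ∤ char 𝓀 · (q_F − 1)` -/

section TameVanishing

variable {F : Type u} [Field F] [ValuativeRel F] [TopologicalSpace F] [IsNonarchimedeanLocalField F]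

/-- **A continuous homomorphism `a : Γ_F → Q` into an abelian group of exponent `p` kills the inertia group when
`p ≠ char 𝓀_F` and `p ∤ q_F − 1`.** Wild inertia is pro-`char 𝓀_F` (`absWildInertia_isProP_holds`), so `a` kills it
(orders divide `gcd(char^k, p) = 1`); for `σ ∈ I_F` and an arithmetic Frobenius `φ`, `φ σ φ⁻¹ σ^{-q_F}` is wild
(`conj_mul_pow_inv_mem_absWildInertia`), so `a σ ^ (q_F - 1) = 1` and the order of `a σ` divides `gcd(p, q_F − 1) = 1`.
(`Hom(I_F^{tame}, Q)^{Frob} = Hom(ℤ/(q_F − 1, p), Q) = 0`.) [cite: SerreLocalFields1979, Ch. IV §2, Ex. 2]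
[cite: SerreInventiones1972, §1.8 Prop. 6] -/
theorem apply_eq_one_of_mem_absInertia_of_not_dvd {Q : Type*} [CommGroup Q]
    (a : absoluteGaloisGroup F →* Q) (hker : IsOpen ((a.ker : Subgroup (absoluteGaloisGroup F)) : Set (absoluteGaloisGroup F)))
    {p : ℕ} (hp : p.Prime) (hpF : ¬ ringChar 𝓀[F] ∣ p) (hpq : ¬ p ∣ residueFieldCard F - 1)
    (hQ : ∀ x : Q, x ^ p = 1) {σ : absoluteGaloisGroup F} (hσ : σ ∈ absInertia F) : a σ = 1 := by
  obtain ⟨ϖ, hϖ⟩ := IsDiscreteValuationRing.exists_irreducible 𝒪[F]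
  have hℓ : (ringChar 𝓀[F]).Prime := ringChar_residueField_prime (F := F)
  have hord : ∀ x : Q, orderOf x ∣ p := fun x ↦ orderOf_dvd_of_pow_eq_one (hQ x)
  have hwild : ∀ τ ∈ absWildInertia F ϖ, a τ = 1 := by
    intro τ hτ
    obtain ⟨k, hk⟩ := absWildInertia_isProP_holds F hϖ hτ a.ker hker
    have h1 : a τ ^ (ringChar 𝓀[F] ^ k) = 1 := by rw [← map_pow]; exact hk
    have hcop' : Nat.Coprime (ringChar 𝓀[F] ^ k) p :=
      Nat.Coprime.pow_left k ((Nat.coprime_primes hℓ hp).mpr (fun h ↦ hpF (h ▸ dvd_rfl)))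
    have h3 : orderOf (a τ) ∣ Nat.gcd (ringChar 𝓀[F] ^ k) p := Nat.dvd_gcd (orderOf_dvd_of_pow_eq_one h1) (hord _)
    rw [hcop'.gcd_eq_one, Nat.dvd_one] at h3
    exact orderOf_eq_one_iff.mp h3
  obtain ⟨φ, hφ⟩ := exists_isAbsArithFrob_holds F
  have hφ1 : IsFrobPow φ 1 := IsAbsArithFrob.isFrobPow_holds hφ
  have hw := conj_mul_pow_inv_mem_absWildInertia hϖ.ne_zero (m := 1) (by exact_mod_cast hφ1) hσ
  have h1 := hwild _ hw
  simp only [map_mul, map_inv, map_pow, pow_one] at h1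
  have h2 : a φ * a σ * (a φ)⁻¹ = a σ := by
    rw [mul_comm (a φ) (a σ), mul_assoc, mul_inv_cancel, mul_one]
  rw [h2, mul_inv_eq_one] at h1
  rcases Nat.eq_zero_or_pos (residueFieldCard F) with hq0 | hq1
  · rw [hq0, pow_zero] at h1; exact h1
  · have h4 : a σ ^ (residueFieldCard F - 1) = 1 := by
      have h5 : a σ ^ (residueFieldCard F - 1) * a σ = 1 * a σ := by
        rw [← pow_succ, Nat.sub_add_cancel hq1, ← h1, one_mul]
      exact mul_right_cancel h5
    have h6 : orderOf (a σ) ∣ Nat.gcd p (residueFieldCard F - 1) :=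
      Nat.dvd_gcd (hord _) (orderOf_dvd_of_pow_eq_one h4)
    rw [((Nat.Prime.coprime_iff_not_dvd hp).mpr hpq).gcd_eq_one, Nat.dvd_one] at h6
    exact orderOf_eq_one_iff.mp h6

end TameVanishing

/-! ## §2 The local inputs at the place above a Bertolini–Darmon admissible prime -/

section Admissible

variable (W : WeierstrassCurve ℚ) [W.IsElliptic] [W.IsGloballyMinimal] (K : Type) [Field K] [NumberField K]
  (p : ℕ) [Fact p.Prime]

omit [W.IsElliptic] [Fact p.Prime] in
/-- `p ∤ q_w − 1` at the place `w` above a BD-admissible `q`: the residue field of `w ∋ q` has `q_w ∣ q²` elements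
(`Nm(w) ∣ Nm(q) = q^{[K:ℚ]}`), so `q_w ∈ {q, q²}` and `q_w − 1 ∣ q² − 1`, while `p ∤ q² − 1`. [cite: BertoliniDarmon2005,
p. 18 (Admissible primes)] -/
theorem not_dvd_residueFieldCard_sub_one_of_admQ (hK2 : Module.finrank ℚ K = 2) (q : AdmQ W K p)
    (w : HeightOneSpectrum (𝓞 K)) (hqw : ((q : ℕ) : 𝓞 K) ∈ w.asIdeal) :
    ¬ p ∣ residueFieldCard (w.adicCompletion K) - 1 := by
  obtain ⟨hqprime, -, -, hsq, -⟩ := q.2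
  rw [Literature.NumberTheory.Automorphic.residueFieldCard_adicCompletion_eq K w]
  have hdvd : w.residueCard ∣ (q : ℕ) ^ 2 := by
    have hle : Ideal.span {((q : ℕ) : 𝓞 K)} ≤ w.asIdeal := by
      rw [Ideal.span_le, Set.singleton_subset_iff]; exact hqw
    have h1 : Ideal.absNorm w.asIdeal ∣ Ideal.absNorm (Ideal.span {((q : ℕ) : 𝓞 K)}) :=
      Ideal.absNorm_dvd_absNorm_of_le hle
    rw [Ideal.absNorm_span_singleton] at h1
    have h2 : (Algebra.norm ℤ ((q : ℕ) : 𝓞 K)).natAbs = (q : ℕ) ^ 2 := by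
      rw [← map_natCast (algebraMap ℤ (𝓞 K)) q, Algebra.norm_algebraMap, NumberField.RingOfIntegers.rank, hK2,
        Int.natAbs_pow, Int.natAbs_natCast]
    rw [h2] at h1
    exact h1
  obtain ⟨k, hk, hk'⟩ := (Nat.dvd_prime_pow hqprime).mp hdvd
  have hne : w.residueCard ≠ 1 := by
    intro h1
    exact w.isPrime.ne_top ((Ideal.absNorm_eq_one_iff).mp h1)
  have hk0 : k ≠ 0 := by rintro rfl; rw [pow_zero] at hk'; exact hne hk'
  have hsub : w.residueCard - 1 ∣ (q : ℕ) ^ 2 - 1 := by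
    rw [hk']
    interval_cases k
    · exact absurd rfl hk0
    · rw [pow_one]; exact Nat.sub_one_dvd_pow_sub_one (q : ℕ) 2
    · exact dvd_rfl
  intro hp
  apply hsq
  have h1 : (p : ℤ) ∣ (((q : ℕ) ^ 2 - 1 : ℕ) : ℤ) := Int.natCast_dvd_natCast.mpr (hp.trans hsub)
  have hq1 : 1 ≤ (q : ℕ) ^ 2 := Nat.one_le_pow _ _ hqprime.pos
  rwa [Nat.cast_sub hq1, Nat.cast_pow, Nat.cast_one] at h1

/-- **`#E[p](K̄)^{Γ_{K_w}} ≥ p` at the place above a BD-admissible prime** (the Frobenius-fixed line): the Frobenius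
`F` of the local picture has a non-zero fixed point (akr-p1 g2 `exists_frob_of_isAdmissiblePrime`), fixed by all of
`G_𝔓 = ⟨F⟩·I_𝔓·Γ_{K(E[p])} ⊇ res Γ_{K_w}` (`LocalFrob.smul_eq_self_of_frob_smul_eq_self`). [cite: BertoliniDarmon2005,
p. 18, §2.2] [cite: NeukirchANT1999, Ch. I §9 (9.4), Ch. II §9 (9.6)] -/
theorem le_natCard_invariants_of_admQ (hK2 : Module.finrank ℚ K = 2) (q : AdmQ W K p)
    (w : HeightOneSpectrum (𝓞 K)) (hqw : ((q : ℕ) : 𝓞 K) ∈ w.asIdeal) :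
    p ≤ Nat.card (GaloisRep.restrictField (w.adicCompletion K)
        ((W.baseChange K).torsionGaloisModule ((p ^ 1 : ℕ) : ℤ))).toTopRep.ρ.invariants := by
  rw [Nat.pow_one]
  have hp : p.Prime := Fact.out
  obtain ⟨hgood, hpv⟩ := hasGoodReductionAt_of_isAdmissiblePrime W K q.2 w hqw
  set ι₀ := closureEmb (K := K) (w.adicCompletion K) with hι₀
  obtain ⟨𝔐, h𝔐⟩ := w.localPrimesAbove_nonempty
  have h𝔓 := HeightOneSpectrum.primeBelow_mem_primesAbove (ι := ι₀) h𝔐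
  haveI := h𝔓.1
  obtain ⟨F, hF, -, P₂, hP₂0, hP₂⟩ := exists_frob_of_isAdmissiblePrime W K hK2 q.2 w hqw h𝔐
  have hI : (w.primeBelow ι₀ 𝔐).inertia (absoluteGaloisGroup K) ≤ torsionFixing (W.baseChange K) (p : ℤ) :=
    inertia_le_torsionFixing (W.baseChange K) (fun h ↦ h hgood) hpv ι₀ h𝔐
  set H := (GaloisRep.restrictField (w.adicCompletion K)
      ((W.baseChange K).torsionGaloisModule (p : ℤ))).toTopRep.ρ.invariants with hHdef
  have hmem : P₂ ∈ H := by
    rw [hHdef, ContRepresentation.mem_invariants]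
    intro σ
    change absGaloisRestrict K (w.adicCompletion K) σ • P₂ = P₂
    have hd : absGaloisRestrict K (w.adicCompletion K) σ ∈
        (w.primeBelow ι₀ 𝔐).decompositionSubgroup (absoluteGaloisGroup K) := by
      rw [← resGal_eq_absGaloisRestrict, resGal_eq]
      exact resGalOfEmb_mem_decompositionSubgroup ι₀ h𝔐 σ
    exact LocalFrob.smul_eq_self_of_frob_smul_eq_self (W.baseChange K) h𝔓 (by exact_mod_cast hp.ne_zero) hF hI
      hP₂ hd
  haveI : Finite (geomTorsion (W.baseChange K) (p : ℤ)) :=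
    finite_torsionPoints_holds (W.baseChange K) (AlgebraicClosure K) (by exact_mod_cast hp.ne_zero)
  have hord : addOrderOf (⟨P₂, hmem⟩ : H.toAddSubgroup) = p := by
    rw [← AddSubgroup.addOrderOf_coe]
    change addOrderOf P₂ = p
    refine addOrderOf_eq_prime ?_ hP₂0
    have := AddSubgroup.torsionBy.nsmul P₂
    exact_mod_cast this
  change p ≤ Nat.card H.toAddSubgroup
  have hdvd := addOrderOf_dvd_natCard (⟨P₂, hmem⟩ : H.toAddSubgroup)
  rw [hord] at hdvd
  exact Nat.le_of_dvd Nat.card_pos hdvd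

/-- **`#H¹(K_w, E[p]) = (#E[p]^{Γ_{K_w}})²` at a finite place `w ∤ p`** (Tate's prime-to-`p` local Euler characteristic
`#H⁰ · #H² = #H¹`, tree THEOREM `natCard_invariants_mul_natCard_two_eq`, with `#H² = #E(K_w)[p] = #H⁰` by bidegree-`(2,0)`
duality and the Weil pairing; the equality form of koly g13's `natCard_galoisCohomology_one_torsion_le_sq`).
[cite: MilneADT2006, Ch. I §2, Thm. 2.8 and Lemma 2.9, Cor. 2.3] -/
theorem natCard_galoisCohomology_one_torsion_eq_sq {K : Type u} [Field K] [NumberField K] (E : WeierstrassCurve K)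
    [E.IsElliptic] (p : ℕ) [Fact p.Prime] (v : HeightOneSpectrum (𝓞 K)) (hpv : (p : 𝓞 K) ∉ v.asIdeal) :
    Nat.card (galoisCohomology ((E.torsionGaloisModule p).toLocal (Sum.inr v)) 1) =
      Nat.card (GaloisRep.restrictField (v.adicCompletion K) (E.torsionGaloisModule p)).toTopRep.ρ.invariants ^ 2 := by
  have hp : p.Prime := Fact.out
  haveI : NeZero p := ⟨hp.ne_zero⟩
  haveI : CharZero (v.adicCompletion K) := charZero_adicCompletion v
  haveI := absoluteGaloisGroup_compactSpace (v.adicCompletion K)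
  haveI : Finite (geomTorsion E ((p : ℕ) : ℤ)) := finite_geomTorsion_of_neZero E p
  have hA : IsPrimaryTorsion p (geomTorsion E p) :=
    IsPrimaryTorsion.of_forall_nsmul_eq_zero (r := 1) fun m => by
      rw [pow_one]; exact AddSubgroup.torsionBy.nsmul m
  obtain ⟨-, h12⟩ := natCard_invariants_mul_natCard_two_eq (v.adicCompletion K)
    (GaloisRep.restrictField (v.adicCompletion K) (E.torsionGaloisModule p) :
      ContinuousRep (absoluteGaloisGroup (v.adicCompletion K)) ℤ (geomTorsion E p)) hA
    (ringChar_residueField_adicCompletion_ne_of_not_mem v p hpv)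
  have h12' : Nat.card (GaloisRep.restrictField (v.adicCompletion K)
        (E.torsionGaloisModule p)).toTopRep.ρ.invariants *
      Nat.card (galoisCohomology (GaloisRep.restrictField (v.adicCompletion K) (E.torsionGaloisModule p)) 2) =
      Nat.card (galoisCohomology ((E.torsionGaloisModule p).toLocal (Sum.inr v)) 1) := h12
  rw [(natCard_galoisCohomology_two_torsion_restrictField E (v.adicCompletion K) p hp.isPrimePow).2,
    ← natCard_invariants_torsion_restrictField E (v.adicCompletion K) hp.ne_zero] at h12'
  rw [← h12', sq]

/-- **`p² ≤ #H¹(K_w, E[p])` at the place above a BD-admissible prime** (in fact `= p²`): §2's `#H¹ = (#H⁰)²` and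
`#H⁰ ≥ p`. [cite: BertoliniDarmon2005, §2.2–§2.3] [cite: MilneADT2006, Ch. I §2, Thm. 2.8] -/
theorem sq_le_natCard_galoisCohomology_one_of_admQ (hK2 : Module.finrank ℚ K = 2) (q : AdmQ W K p)
    (w : HeightOneSpectrum (𝓞 K)) (hqw : ((q : ℕ) : 𝓞 K) ∈ w.asIdeal) :
    p ^ 2 ≤ Nat.card (galoisCohomology (((W.baseChange K).torsionGaloisModule ((p ^ 1 : ℕ) : ℤ)).toLocal
      (Sum.inr w)) 1) := by
  have h := le_natCard_invariants_of_admQ W K p hK2 q w hqw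
  rw [Nat.pow_one] at h ⊢
  obtain ⟨-, hpv⟩ := hasGoodReductionAt_of_isAdmissiblePrime W K q.2 w hqw
  rw [Int.cast_natCast] at hpv
  rw [natCard_galoisCohomology_one_torsion_eq_sq (W.baseChange K) p w hpv]
  exact Nat.pow_le_pow_left h 2

/-- **The augmentation subgroup has `≥ p` elements** at the place above a BD-admissible prime: the Frobenius `F` of the
local picture moves some `P₁ ∈ E[p](K̄)` (akr-p1 g2 `exists_frob_of_isAdmissiblePrime`, `Frob_q² ≠ 1`) and `F = res σ`
for some `σ ∈ Γ_{K_w}` (Neukirch II (9.6)), so `res σ · P₁ − P₁ ≠ 0` lies in it. [cite: BertoliniDarmon2005, §2.2–§2.3]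
[cite: NeukirchANT1999, Ch. II §9 Prop. (9.6)] -/
theorem le_natCard_augmentation_of_admQ (hK2 : Module.finrank ℚ K = 2) (q : AdmQ W K p)
    (w : HeightOneSpectrum (𝓞 K)) (hqw : ((q : ℕ) : 𝓞 K) ∈ w.asIdeal) :
    p ≤ Nat.card (AddSubgroup.closure {m : geomTorsion (W.baseChange K) ((p ^ 1 : ℕ) : ℤ) |
        ∃ (τ : absoluteGaloisGroup (w.adicCompletion K)) (y : geomTorsion (W.baseChange K) ((p ^ 1 : ℕ) : ℤ)),
          m = absGaloisRestrict K (w.adicCompletion K) τ • y - y}) := by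
  rw [Nat.pow_one]
  have hp : p.Prime := Fact.out
  set ι₀ := closureEmb (K := K) (w.adicCompletion K) with hι₀
  obtain ⟨𝔐, h𝔐⟩ := w.localPrimesAbove_nonempty
  have h𝔓 := HeightOneSpectrum.primeBelow_mem_primesAbove (ι := ι₀) h𝔐
  haveI := h𝔓.1
  obtain ⟨F, hF, ⟨P₁, hP₁⟩, -⟩ := exists_frob_of_isAdmissiblePrime W K hK2 q.2 w hqw h𝔐
  obtain ⟨σ, hσ⟩ := exists_apply_eq_smul_of_mem_decompositionSubgroup ι₀ h𝔐 hF.mem_stabilizer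
  have hresσ : absGaloisRestrict K (w.adicCompletion K) σ = F := by
    rw [← resGal_eq_absGaloisRestrict, resGal_eq]
    exact resGalOfEmb_eq_of_apply_eq ι₀ hσ
  set A := AddSubgroup.closure {m : geomTorsion (W.baseChange K) (p : ℤ) |
        ∃ (τ : absoluteGaloisGroup (w.adicCompletion K)) (y : geomTorsion (W.baseChange K) (p : ℤ)),
          m = absGaloisRestrict K (w.adicCompletion K) τ • y - y} with hA
  have hmem : F • P₁ - P₁ ∈ A := AddSubgroup.subset_closure ⟨σ, P₁, by rw [hresσ]⟩
  have hne : F • P₁ - P₁ ≠ 0 := fun h ↦ hP₁ (sub_eq_zero.mp h)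
  haveI : Finite (geomTorsion (W.baseChange K) (p : ℤ)) :=
    finite_torsionPoints_holds (W.baseChange K) (AlgebraicClosure K) (by exact_mod_cast hp.ne_zero)
  have hord : addOrderOf (⟨F • P₁ - P₁, hmem⟩ : A) = p := by
    rw [← AddSubgroup.addOrderOf_coe]
    change addOrderOf (F • P₁ - P₁) = p
    refine addOrderOf_eq_prime ?_ hne
    have := AddSubgroup.torsionBy.nsmul (F • P₁ - P₁)
    exact_mod_cast this
  have hdvd := addOrderOf_dvd_natCard (⟨F • P₁ - P₁, hmem⟩ : A)
  rw [hord] at hdvd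
  exact Nat.le_of_dvd Nat.card_pos hdvd

end Admissible

/-! ## §3 The count: `#H¹(K_w, E[p]) ≤ #Ltor · #Ltor` -/

section Count

variable (W : WeierstrassCurve ℚ) [W.IsElliptic] [W.IsGloballyMinimal] (K : Type) [Field K] [NumberField K]
  (p : ℕ) [Fact p.Prime]

/-- **(Lag-tor), count clause `htorCard`** for `Ltor w := toricLocalCondition (W/K) K_w p` at the place `w` of the
quadratic field `K` above a Bertolini–Darmon admissible prime: `#H¹(K_w, E[p]) ≤ #Ltor · #Ltor` (in fact both sides are
`p²`). Proof in the module docstring (§3): the value-at-Frobenius map `H¹(K_w, E[p]) → E[p]/A` modulo `A = ⟨res τ·y − y⟩`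
has fibres inside cosets of `Ltor` (§1: homomorphisms of exponent `p` are unramified as `p ∤ char 𝓀 · (q_w − 1)`;
`Γ/I` is generated by Frobenius), `#(E[p]/A) ≤ p` and `#H¹ ≥ p²` (§2). [cite: BertoliniDarmon2005, §2.2–§2.3
(dim H¹_ord = 1)] [cite: WZhang2014, §4.1] [cite: MilneADT2006, Ch. I §2, Thm. 2.8] -/
theorem natCard_galoisCohomology_one_le_mul_natCard_toricLocalCondition (hK2 : Module.finrank ℚ K = 2)
    (q : AdmQ W K p) (w : HeightOneSpectrum (𝓞 K)) (hqw : ((q : ℕ) : 𝓞 K) ∈ w.asIdeal) :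
    Nat.card (galoisCohomology (((W.baseChange K).torsionGaloisModule ((p ^ 1 : ℕ) : ℤ)).toLocal (Sum.inr w)) 1) ≤
      Nat.card (toricLocalCondition (W.baseChange K) (w.adicCompletion K) ((p ^ 1 : ℕ) : ℤ)) *
        Nat.card (toricLocalCondition (W.baseChange K) (w.adicCompletion K) ((p ^ 1 : ℕ) : ℤ)) := by
  have hp : p.Prime := Fact.out
  haveI : NeZero (p ^ 1 : ℕ) := ⟨pow_ne_zero 1 hp.ne_zero⟩
  set L := w.adicCompletion K with hL
  set T := geomTorsion (W.baseChange K) ((p ^ 1 : ℕ) : ℤ) with hT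
  set X := DiscreteGaloisModule.toTopRep
    (GaloisRep.restrictField L ((W.baseChange K).torsionGaloisModule ((p ^ 1 : ℕ) : ℤ))) with hX
  set H := galoisCohomology (((W.baseChange K).torsionGaloisModule ((p ^ 1 : ℕ) : ℤ)).toLocal (Sum.inr w)) 1 with hH
  set A : AddSubgroup T := AddSubgroup.closure {m : T |
      ∃ (τ : absoluteGaloisGroup L) (y : T), m = absGaloisRestrict K L τ • y - y} with hA
  set Ltor := toricLocalCondition (W.baseChange K) L ((p ^ 1 : ℕ) : ℤ) with hLtor
  haveI : Finite T := finite_geomTorsion_of_neZero (W.baseChange K) (p ^ 1)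
  haveI : Finite H := KummerPT.finite_galoisCohomology_toLocal_inr (W.baseChange K) (p ^ 1) w
  have hpT : ∀ y : T, p • y = 0 := fun y ↦ by
    have h := AddSubgroup.torsionBy.nsmul y
    have h' : (p ^ 1) • y = 0 := by exact_mod_cast h
    exact (congrArg (fun k : ℕ ↦ k • y) (pow_one p)).symm.trans h'
  have hpF : ¬ ringChar 𝓀[L] ∣ p := by
    obtain ⟨-, hpv⟩ := hasGoodReductionAt_of_isAdmissiblePrime W K q.2 w hqw
    exact not_ringChar_residueField_adicCompletion_dvd (by rw [Int.cast_natCast] at hpv; exact hpv)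
  have hpq := not_dvd_residueFieldCard_sub_one_of_admQ W K p hK2 q w hqw
  obtain ⟨φ, hφ⟩ := exists_isAbsArithFrob_holds L
  let π : T →+ T ⧸ A := QuotientAddGroup.mk' A
  have hπres : ∀ (σ : absoluteGaloisGroup L) (y : T), π (absGaloisRestrict K L σ • y) = π y := by
    intro σ y
    rw [← sub_eq_zero, ← map_sub, QuotientAddGroup.mk'_apply, QuotientAddGroup.eq_zero_iff]
    exact AddSubgroup.subset_closure ⟨σ, y, rfl⟩
  have hcoc : ∀ (ψ : contOneCocycles X) (g h : absoluteGaloisGroup L),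
      ψ.1 (g * h) = ψ.1 g + absGaloisRestrict K L g • ψ.1 h := fun ψ g h ↦ ψ.2 g h
  let a : contOneCocycles X → (absoluteGaloisGroup L →* Multiplicative (T ⧸ A)) := fun ψ ↦
    { toFun := fun σ ↦ Multiplicative.ofAdd (π (ψ.1 σ))
      map_one' := by rw [contOneCocycles.apply_one, map_zero, ofAdd_zero]
      map_mul' := fun g h ↦ by rw [hcoc, map_add, hπres, ofAdd_add] }
  have ha : ∀ ψ σ, a ψ σ = Multiplicative.ofAdd (π (ψ.1 σ)) := fun _ _ ↦ rfl
  have hker : ∀ ψ, IsOpen (((a ψ).ker : Subgroup (absoluteGaloisGroup L)) : Set (absoluteGaloisGroup L)) := by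
    intro ψ
    have hset : (((a ψ).ker : Subgroup (absoluteGaloisGroup L)) : Set (absoluteGaloisGroup L)) =
        ψ.1 ⁻¹' (π ⁻¹' {0}) := by
      ext σ
      rw [SetLike.mem_coe, MonoidHom.mem_ker, ha, Set.mem_preimage, Set.mem_preimage, Set.mem_singleton_iff]
      exact ⟨fun h ↦ Multiplicative.ofAdd.injective (by rw [h, ofAdd_zero]), fun h ↦ by rw [h, ofAdd_zero]⟩
    rw [hset]
    exact (isOpen_discrete _).preimage ψ.1.continuous
  have hunr : ∀ ψ, absInertia L ≤ (a ψ).ker := fun ψ τ hτ ↦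
    apply_eq_one_of_mem_absInertia_of_not_dvd (a ψ) (hker ψ) hp hpF hpq
      (fun x ↦ by
        obtain ⟨y, hy⟩ := QuotientAddGroup.mk'_surjective A (Multiplicative.toAdd x)
        rw [← ofAdd_toAdd x, ← hy, ← ofAdd_nsmul, ← map_nsmul, hpT, map_zero, ofAdd_zero]) hτ
  have hdet : ∀ ψ σ, ∃ n : ℤ, a ψ σ = a ψ φ ^ n := fun ψ σ ↦
    exists_zpow_eq_of_absInertia_le_ker L (a ψ) (hker ψ) (hunr ψ) hφ σ
  choose rep hrep using oneCocycleClass_surjective X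
  let f : H → T ⧸ A := fun x ↦ π ((rep x).1 φ)
  have hfib : ∀ x y : H, f x = f y → x - y ∈ Ltor := by
    intro x y hxy
    set ψ := rep x - rep y with hψ
    have hψapply : ∀ σ, ψ.1 σ = (rep x).1 σ - (rep y).1 σ := fun σ ↦ rfl
    have hφ0 : a ψ φ = 1 := by
      rw [ha, hψapply, map_sub, show π ((rep x).1 φ) = π ((rep y).1 φ) from hxy, sub_self, ofAdd_zero]
    have hall : ∀ σ, ψ.1 σ ∈ A := by
      intro σ
      obtain ⟨n, hn⟩ := hdet ψ σ
      rw [hφ0, one_zpow, ha, ofAdd_eq_one, QuotientAddGroup.mk'_apply, QuotientAddGroup.eq_zero_iff] at hn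
      exact hn
    refine ⟨ψ, hall, ?_⟩
    rw [hψ, oneCocycleClass_sub, hrep, hrep]
    rfl
  let c : T ⧸ A → H := fun t ↦ if h : ∃ x, f x = t then h.choose else 0
  have hc : ∀ x, f (c (f x)) = f x := fun x ↦ by
    have h : ∃ x', f x' = f x := ⟨x, rfl⟩
    simp only [c, dif_pos h]
    exact h.choose_spec
  let g : H → (T ⧸ A) × Ltor := fun x ↦ (f x, ⟨x - c (f x), hfib x (c (f x)) (hc x).symm⟩)
  have hg : Function.Injective g := by
    intro x y hxy
    simp only [g, Prod.mk.injEq, Subtype.mk.injEq] at hxy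
    obtain ⟨h1, h2⟩ := hxy
    rw [h1] at h2
    exact sub_left_injective h2
  haveI : Finite (T ⧸ A) := Finite.of_surjective _ (QuotientAddGroup.mk'_surjective A)
  haveI : Finite (galoisCohomology (GaloisRep.restrictField L
      ((W.baseChange K).torsionGaloisModule ((p ^ 1 : ℕ) : ℤ))) 1) := ‹Finite H›
  haveI : Finite Ltor := Subtype.finite
  have hcard1 : Nat.card H ≤ Nat.card (T ⧸ A) * Nat.card Ltor := by
    rw [← Nat.card_prod]; exact Nat.card_le_card_of_injective g hg
  have hTA : Nat.card T = Nat.card (T ⧸ A) * Nat.card A := AddSubgroup.card_eq_card_quotient_mul_card_addSubgroup A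
  have hT2 : Nat.card T = (p ^ 1) ^ 2 :=
    card_torsionPoints_eq_sq_holds (W.baseChange K) (AlgebraicClosure K) (n := p ^ 1)
      (by exact_mod_cast pow_ne_zero 1 hp.ne_zero)
  rw [pow_one] at hT2
  have hA' : p ≤ Nat.card A := le_natCard_augmentation_of_admQ W K p hK2 q w hqw
  have hQ : Nat.card (T ⧸ A) ≤ p := by
    apply Nat.le_of_mul_le_mul_right _ hp.pos
    calc Nat.card (T ⧸ A) * p ≤ Nat.card (T ⧸ A) * Nat.card A := Nat.mul_le_mul_left _ hA'
      _ = p * p := by rw [← hTA, hT2, sq]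
  have hH2 : p ^ 2 ≤ Nat.card H := sq_le_natCard_galoisCohomology_one_of_admQ W K p hK2 q w hqw
  have hcard2 : Nat.card H ≤ p * Nat.card Ltor := hcard1.trans (Nat.mul_le_mul_right _ hQ)
  have hpL : p ≤ Nat.card Ltor := by
    apply Nat.le_of_mul_le_mul_left _ hp.pos
    calc p * p = p ^ 2 := (sq p).symm
      _ ≤ Nat.card H := hH2
      _ ≤ p * Nat.card Ltor := hcard2
  exact hcard2.trans (Nat.mul_le_mul_right _ hpL)

end Count

end Summit.BirchSwinnertonDyer.BirchSwinnertonDyer.Theorems.AdditiveKoly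

end
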